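import Summits.Parity.BatemanHorn.Theorems.AlmostPrimeZerosSystemZeroRepulsionApHolRieszBoundCore
import Summits.Parity.BatemanHorn.Theorems.AlmostPrimeZerosLinearCappedRepulsionRieszDiffNegligible
import HarnessLib

/-!
# Crux `SystemZeroRepulsion` (stmt-Parity-11291), line `smooth-rough-lattice-acquisition`
(skeleton v3, lead c2): stub `stub_apHolRieszBound`, part 2 of 2 — the pole-free Riesz engine

Class `linₐ` of the crux (`k = 1`, `f = aX + b`, `a ≥ 2`): for a non-principal character the
Dirichlet series `F(s) = Σ a(n) n^{-s}` is HOLOMORPHIC (no pole, no branch point) on a classical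
region `zfr c = {σ > 1 − c/log(|t|+4)}` with `‖F(s)‖ ≤ B (K log(|t|+4))^R`.  This file turns that
into the negligibility of the Riesz mean `A₁(x) = Σ_{n ≤ x} a(n)(x − n)`:
`‖A₁(x)‖ ≤ x² (log x)^{−R} e^{−(log log x)³} B` for `x ≥ X₀(c, K)`, uniformly in `1 ≤ R ≤ log log x`,
`B ≥ 0`, `a`, `F` (the registered stub `stub_apHolRieszBound`).  Route (Landau; Montgomery–Vaughan
§7.4 p. 178 without the keyhole): the fixed-parameter contour estimate of part 1
(`stub_apHolRieszBoundCore`) at `σ₀ = 1 + 1/log x`, `T = exp(3(log log x)³)`,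
`σ₁ = 1 − c'/log(T+4)`, `c' = min(c,1)/2`, and the elementary negligibility lemmas
`RieszDiff.tails_le / hor_le / far_le / eventually_master` of the tree's `ζ`-engine.
Everything here is PROVED.

## References

* [MontgomeryVaughan2007] H. L. Montgomery, R. C. Vaughan, *Multiplicative Number Theory I*,
  CUP 2007, §7.4, proof of Theorem 7.17 (pp. 177–178); §6.2 Theorem 6.9.
* [LandauMathAnn1903] E. Landau, *Neuer Beweis des Primzahlsatzes und Beweis des
  Primidealsatzes*, Math. Ann. 56 (1903), 645–670, §§5–7.
-/

noncomputable section

open Filter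
open scoped Real
open Summit.Parity.BatemanHorn.Cruxes.LinearCappedRepulsion.JensenStieltjesMajorant

namespace Summit.Parity.BatemanHorn.Cruxes.SystemZeroRepulsion.NearFar

/-- `(K log(T+4))^R ≤ e^{R log(2K)} (log(T+3))^R` (`K ≥ 1`, `R ≥ 0`, `T ≥ 0`; `T + 4 ≤ (T+3)²`).
[folklore] -/
theorem apHol_factor_le {K R T : ℝ} (hK : 1 ≤ K) (hR : 0 ≤ R) (hT : 0 ≤ T) :
    (K * Real.log (T + 4)) ^ R ≤ Real.exp (R * Real.log (2 * K)) * Real.log (T + 3) ^ R := by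
  have hlog3 : 0 ≤ Real.log (T + 3) := Real.log_nonneg (by linarith)
  have hlog4 : 0 ≤ Real.log (T + 4) := Real.log_nonneg (by linarith)
  have h43 : Real.log (T + 4) ≤ 2 * Real.log (T + 3) := by
    have h : T + 4 ≤ (T + 3) ^ 2 := by nlinarith
    have := Real.log_le_log (by linarith) h
    rw [Real.log_pow] at this
    push_cast at this
    linarith
  have h1 : K * Real.log (T + 4) ≤ (2 * K) * Real.log (T + 3) := by
    calc K * Real.log (T + 4) ≤ K * (2 * Real.log (T + 3)) :=
          mul_le_mul_of_nonneg_left h43 (by linarith)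
      _ = (2 * K) * Real.log (T + 3) := by ring
  calc (K * Real.log (T + 4)) ^ R ≤ ((2 * K) * Real.log (T + 3)) ^ R :=
        Real.rpow_le_rpow (by positivity) h1 hR
    _ = (2 * K) ^ R * Real.log (T + 3) ^ R := Real.mul_rpow (by positivity) hlog3
    _ = Real.exp (R * Real.log (2 * K)) * Real.log (T + 3) ^ R := by
        rw [Real.rpow_def_of_pos (by positivity), mul_comm (Real.log (2 * K)) R]

/-- **Stub D (`stub_apHolRieszBound`): the pole-free Riesz engine.**  For `c > 0`, `K ≥ 1` there
is `X₀ = X₀(c, K)` such that for all `R ≥ 1`, `B ≥ 0`, coefficients `a` and `F` holomorphic on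
`zfr c` with `‖F(s)‖ ≤ B (K log(|t|+4))^R` there, `Σ a(n) n^{-s} = F(s)` (`σ > 1`, absolutely
convergent) and `Σ ‖a(n)‖ n^{-σ} ≤ B (σ−1)^{−R}` (`1 < σ ≤ 2`): for `x ≥ X₀` with `R ≤ log log x`,
`‖Σ_{n ≤ x} a(n)(x − n)‖ ≤ x² (log x)^{−R} e^{−(log log x)³} B`.
Proof: `stub_apHolRieszBoundCore` at `σ₀ = 1 + 1/L` (`L = log x = e^ℓ`), `T = exp(3ℓ³)`,
`σ₁ = 1 − c'/log(T+4)`, `c' = min(c,1)/2`; the three kinds of pieces are each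
`≤ ¼ x² B e^{−ℓ³ − (R+1)ℓ}` by `RieszDiff.tails_le / hor_le / far_le` (with `C₀ = log(2K)`,
`(K log(T+4))^R ≤ e^{R C₀} log(T+3)^R`) once `ℓ ≥ C₀ + 3` and `4(C₀ + 20) ℓ⁶/c' ≤ e^ℓ`
(`RieszDiff.eventually_master`), and `(5/4)/(2π) ≤ 1`, `e^{−ℓ} ≤ 1`.
[cite: MontgomeryVaughan2007, §7.4 pp. 177–178] -/
theorem stub_apHolRieszBound :
    ∀ (c K : ℝ), 0 < c → 1 ≤ K → ∃ X₀ : ℝ, ∀ (R B : ℝ) (a : ℕ → ℂ) (F : ℂ → ℂ), 1 ≤ R → 0 ≤ B →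
      DifferentiableOn ℂ F (Literature.NumberTheory.LFunctions.ClassicalPsiData.zfr c) →
      (∀ s ∈ Literature.NumberTheory.LFunctions.ClassicalPsiData.zfr c, ‖F s‖ ≤ B * (K * Real.log (|s.im| + 4)) ^ R) →
      (∀ σ : ℝ, 1 < σ → LSeriesSummable a σ) →
      (∀ s : ℂ, 1 < s.re → LSeries a s = F s) →
      (∀ σ : ℝ, 1 < σ → σ ≤ 2 → ∑' n : ℕ, ‖LSeries.term a σ n‖ ≤ B / (σ - 1) ^ R) →
      ∀ x : ℝ, X₀ ≤ x → R ≤ Real.log (Real.log x) →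
        ‖∑ n ∈ Finset.Ioc 0 ⌊x⌋₊, a n * ((x : ℂ) - n)‖ ≤
          x ^ 2 * Real.log x ^ (-R) * Real.exp (-(Real.log (Real.log x)) ^ 3) * B := by
  intro c K hc hK
  -- the constants `c' = min(c,1)/2`, `C₀ = log(2K)`, `K' = 4(C₀ + 20)/c'`, and `ℓ₀`
  obtain ⟨c', hc'def⟩ : ∃ c' : ℝ, c' = min c 1 / 2 := ⟨_, rfl⟩
  have hc1 : 0 < min c 1 := lt_min hc one_pos
  have hc'0 : 0 < c' := by rw [hc'def]; exact half_pos hc1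
  have hc'c : c' < c := by rw [hc'def]; have := min_le_left c 1; linarith
  have hc'h : c' ≤ 1 / 2 := by rw [hc'def]; have := min_le_right c 1; linarith
  obtain ⟨C₀, hC₀def⟩ : ∃ C₀ : ℝ, C₀ = Real.log (2 * K) := ⟨_, rfl⟩
  have hC₀0 : 0 ≤ C₀ := by rw [hC₀def]; exact Real.log_nonneg (by linarith)
  obtain ⟨K', hK'def⟩ : ∃ K' : ℝ, K' = 4 * (C₀ + 20) / c' := ⟨_, rfl⟩
  obtain ⟨ℓ₀, hℓ₀⟩ := Filter.eventually_atTop.1 (RieszDiff.eventually_master (C₀ + 3) K' one_pos)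
  refine ⟨Real.exp (Real.exp ℓ₀), ?_⟩
  intro R B a F hR1 hB0 hFd hFb hsum hLF hmaj x hxX hRℓx
  -- the scales `L = log x = e^ℓ`, `ℓ ≥ ℓ₀`
  have hX1 : 1 < Real.exp (Real.exp ℓ₀) := by
    rw [← Real.exp_zero]; exact Real.exp_lt_exp.2 (Real.exp_pos ℓ₀)
  have hx1 : 1 < x := hX1.trans_le hxX
  have hx0 : 0 < x := by linarith
  set L : ℝ := Real.log x with hLdef
  set ℓ : ℝ := Real.log L with hℓdef
  have hL0 : 0 < L := Real.log_pos hx1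
  have hℓ₀ℓ : ℓ₀ ≤ ℓ := by
    have h1 : Real.exp ℓ₀ ≤ L := by rw [hLdef, Real.le_log_iff_exp_le hx0]; exact hxX
    rw [hℓdef, Real.le_log_iff_exp_le hL0]; exact h1
  obtain ⟨hℓ2, hℓC, hKℓ, -⟩ := hℓ₀ ℓ hℓ₀ℓ
  obtain ⟨-, -, -, hLℓ, hL7, -, -⟩ := RieszDiff.scales hx1 hLdef hℓdef hℓ2
  have hℓ0 : 0 < ℓ := by linarith
  have hℓ3 : 8 ≤ ℓ ^ 3 := by
    have := pow_le_pow_left₀ (by norm_num : (0:ℝ) ≤ 2) hℓ2 3; norm_num at this; exact this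
  have hR0 : 0 ≤ R := by linarith
  have hRℓ : R ≤ ℓ := hRℓx
  -- the height `T = exp(3ℓ³)`: `3ℓ³ ≤ log(T+4) ≤ 4ℓ³`
  set T : ℝ := Real.exp (3 * ℓ ^ 3) with hTdef
  obtain ⟨hT3, -, -⟩ := RieszDiff.height_bounds hℓ2 hTdef
  have hT0 : 0 < T := by linarith
  have hlogT4 : 3 * ℓ ^ 3 ≤ Real.log (T + 4) := by
    rw [Real.le_log_iff_exp_le (by linarith), ← hTdef]; linarith
  have hlogT4' : Real.log (T + 4) ≤ 4 * ℓ ^ 3 := by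
    rw [Real.log_le_iff_le_exp (by linarith)]
    have e : Real.exp (4 * ℓ ^ 3) = T * Real.exp (ℓ ^ 3) := by
      rw [hTdef, ← Real.exp_add]; ring_nf
    have h9 : 9 ≤ Real.exp (ℓ ^ 3) := by linarith [Real.add_one_le_exp (ℓ ^ 3)]
    have := mul_le_mul_of_nonneg_left h9 hT0.le
    rw [e]; linarith
  have hlogT40 : 0 < Real.log (T + 4) := by linarith
  have hlogT30 : 0 ≤ Real.log (T + 3) := Real.log_nonneg (by linarith)
  -- the abscissae `σ₀ = 1 + 1/L`, `σ₁ = 1 − c'/log(T+4) ∈ [3/4, 1]`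
  obtain ⟨σ₀, hσ₀def⟩ : ∃ σ₀ : ℝ, σ₀ = 1 + 1 / L := ⟨_, rfl⟩
  have h1L : 0 < 1 / L := by positivity
  have h1L1 : 1 / L ≤ 1 := by rw [div_le_one hL0]; linarith
  have hσ₀1 : 1 < σ₀ := by rw [hσ₀def]; linarith
  have hσ₀2 : σ₀ ≤ 2 := by rw [hσ₀def]; linarith
  obtain ⟨σ₁, hσ₁def⟩ : ∃ σ₁ : ℝ, σ₁ = 1 - c' / Real.log (T + 4) := ⟨_, rfl⟩
  have h1σ₁pos : 0 < c' / Real.log (T + 4) := div_pos hc'0 hlogT40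
  have h1σ₁le : c' / Real.log (T + 4) ≤ 1 / 4 := by
    rw [div_le_iff₀ hlogT40]; linarith
  have hσ₁1 : σ₁ ≤ 1 := by rw [hσ₁def]; linarith
  have hσ₁34 : 3 / 4 ≤ σ₁ := by rw [hσ₁def]; linarith
  have hσ₁₀ : σ₁ ≤ σ₀ := by linarith
  have hσ₁c : 1 - c' / Real.log (T + 4) ≤ σ₁ := hσ₁def.symm.le
  -- `β = L(1 − σ₁) ≥ (C₀ + 20) ℓ³` (from `K' ℓ⁶ ≤ e^ℓ = L`)
  have hβ : (C₀ + 20) * ℓ ^ 3 ≤ L * (1 - σ₁) := by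
    have hL' : K' * ℓ ^ 6 ≤ L := by rw [hLℓ]; exact hKℓ
    have h1b_ge : c' / (4 * ℓ ^ 3) ≤ 1 - σ₁ := by
      rw [hσ₁def, sub_sub_cancel]
      exact div_le_div_of_nonneg_left hc'0.le hlogT40 hlogT4'
    calc (C₀ + 20) * ℓ ^ 3 = (K' * ℓ ^ 6) * (c' / (4 * ℓ ^ 3)) := by
          rw [hK'def]; field_simp
      _ ≤ L * (1 - σ₁) := mul_le_mul hL' h1b_ge (by positivity) hL0.le
  -- the contour estimate at these parameters
  have hcore := stub_apHolRieszBoundCore c K R B a F x σ₀ σ₁ T c' hK hR0 hB0 hFd hFb (hsum σ₀ hσ₀1)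
    hLF hx1.le hσ₀1 hc'0.le hc'c hT0 (by linarith) hσ₁₀ hσ₁c
  refine hcore.trans ?_
  -- the unit `U = x² B e^{−ℓ³ − (R+1)ℓ}` and the sizes of the three kinds of pieces
  obtain ⟨U, hUdef⟩ : ∃ U : ℝ, U = x ^ 2 * B * Real.exp (-ℓ ^ 3 - (R + 1) * ℓ) := ⟨_, rfl⟩
  have hU0 : 0 ≤ U := by rw [hUdef]; positivity
  have hfac := apHol_factor_le hK hR0 hT0.le (T := T)
  rw [← hC₀def] at hfac
  have hfac0 : 0 ≤ Real.exp (R * C₀) * Real.log (T + 3) ^ R := by positivity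
  have h2x0 : x ^ (1 + σ₀) ≤ (2 * x) ^ (1 + (1 + 1 / L)) := by
    rw [hσ₀def]; exact Real.rpow_le_rpow hx0.le (by linarith) (by linarith)
  have h2x1 : x ^ (1 + σ₁) ≤ (2 * x) ^ (1 + σ₁) :=
    Real.rpow_le_rpow hx0.le (by linarith) (by linarith)
  -- tails
  have hS : ∑' n : ℕ, ‖LSeries.term a σ₀ n‖ ≤ B / (1 / L) ^ R := by
    have := hmaj σ₀ hσ₀1 hσ₀2
    have e : σ₀ - 1 = 1 / L := by rw [hσ₀def]; ring
    rwa [e] at this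
  have hS0 : 0 ≤ ∑' n : ℕ, ‖LSeries.term a σ₀ n‖ := tsum_nonneg fun n ↦ norm_nonneg _
  have ht := RieszDiff.tails_le hx1 hLdef hℓdef hℓ2 hRℓ hB0 hTdef
  have s12 : x ^ (1 + σ₀) * (∑' n : ℕ, ‖LSeries.term a σ₀ n‖) / T ≤ U / 4 := by
    have h1 : x ^ (1 + σ₀) * (∑' n : ℕ, ‖LSeries.term a σ₀ n‖) / T ≤
        (2 * x) ^ (1 + (1 + 1 / L)) * (B / (1 / L) ^ R) / T :=
      div_le_div_of_nonneg_right (mul_le_mul h2x0 hS hS0 (by positivity)) hT0.le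
    rw [hUdef]; linarith
  -- horizontal sides
  have hho := RieszDiff.hor_le hx1 hLdef hℓdef hℓ2 hℓC hC₀0 hR0 hRℓ hB0 hTdef
    (by linarith : (0 : ℝ) ≤ σ₁) (by linarith : σ₁ ≤ 1 + 1 / L)
  have s45 : (σ₀ - σ₁) * (x ^ (1 + σ₀) * (B * (K * Real.log (T + 4)) ^ R) / T ^ 2) ≤ U / 4 := by
    have h1 : x ^ (1 + σ₀) * (B * (K * Real.log (T + 4)) ^ R) / T ^ 2 ≤
        (2 * x) ^ (1 + (1 + 1 / L)) * (Real.exp (R * C₀) * Real.log (T + 3) ^ R) * B / T ^ 2 := by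
      refine div_le_div_of_nonneg_right ?_ (by positivity)
      calc x ^ (1 + σ₀) * (B * (K * Real.log (T + 4)) ^ R)
          ≤ (2 * x) ^ (1 + (1 + 1 / L)) * (B * (Real.exp (R * C₀) * Real.log (T + 3) ^ R)) :=
            mul_le_mul h2x0 (mul_le_mul_of_nonneg_left hfac hB0) (by positivity) (by positivity)
        _ = _ := by ring
    calc (σ₀ - σ₁) * (x ^ (1 + σ₀) * (B * (K * Real.log (T + 4)) ^ R) / T ^ 2)
        ≤ (σ₀ - σ₁) * ((2 * x) ^ (1 + (1 + 1 / L)) *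
            (Real.exp (R * C₀) * Real.log (T + 3) ^ R) * B / T ^ 2) :=
          mul_le_mul_of_nonneg_left h1 (by linarith)
      _ = (1 + 1 / L - σ₁) * ((2 * x) ^ (1 + (1 + 1 / L)) *
            (Real.exp (R * C₀) * Real.log (T + 3) ^ R) * B / T ^ 2) := by rw [hσ₀def]
      _ ≤ U / 4 := by rw [hUdef]; linarith
  -- left side
  have hfa := RieszDiff.far_le hx1 hLdef hℓdef hℓ2 hC₀0 hR0 hRℓ hB0 hTdef hσ₁1 hβ
  have s3 : 4 * π * (x ^ (1 + σ₁) * (B * (K * Real.log (T + 4)) ^ R)) ≤ U / 4 := by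
    have h1 : x ^ (1 + σ₁) * (B * (K * Real.log (T + 4)) ^ R) ≤
        (2 * x) ^ (1 + σ₁) * (Real.exp (R * C₀) * Real.log (T + 3) ^ R) * B := by
      calc x ^ (1 + σ₁) * (B * (K * Real.log (T + 4)) ^ R)
          ≤ (2 * x) ^ (1 + σ₁) * (B * (Real.exp (R * C₀) * Real.log (T + 3) ^ R)) :=
            mul_le_mul h2x1 (mul_le_mul_of_nonneg_left hfac hB0) (by positivity) (by positivity)
        _ = _ := by ring
    have h2 := mul_le_mul_of_nonneg_left h1 (by positivity : (0 : ℝ) ≤ 4 * π)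
    rw [hUdef]; linarith
  -- `U ≤ x² L^{−R} e^{−ℓ³} B`
  have hUle : U ≤ x ^ 2 * L ^ (-R) * Real.exp (-ℓ ^ 3) * B := by
    rw [hUdef, Real.rpow_def_of_pos hL0, ← hℓdef]
    have e : x ^ 2 * Real.exp (ℓ * -R) * Real.exp (-ℓ ^ 3) * B =
        x ^ 2 * B * Real.exp (-ℓ ^ 3 - (R + 1) * ℓ + ℓ) := by
      rw [show -ℓ ^ 3 - (R + 1) * ℓ + ℓ = ℓ * -R + -ℓ ^ 3 by ring, Real.exp_add]; ring
    rw [e]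
    exact mul_le_mul_of_nonneg_left (Real.exp_le_exp.2 (by linarith)) (by positivity)
  -- conclusion: `(1/2π)·(5U/4) ≤ U`
  have hπ : 1 / (2 * π) ≤ 1 / 6 :=
    div_le_div_of_nonneg_left (by norm_num) (by norm_num) (by linarith [Real.pi_gt_three])
  calc 1 / (2 * π) * (2 * (x ^ (1 + σ₀) * (∑' n : ℕ, ‖LSeries.term a σ₀ n‖) / T) +
        4 * π * (x ^ (1 + σ₁) * (B * (K * Real.log (T + 4)) ^ R)) +
        2 * ((σ₀ - σ₁) * (x ^ (1 + σ₀) * (B * (K * Real.log (T + 4)) ^ R) / T ^ 2)))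
      ≤ 1 / (2 * π) * (5 * (U / 4)) := by
        refine mul_le_mul_of_nonneg_left ?_ (by positivity)
        linarith [s12, s3, s45]
    _ ≤ 1 / 6 * (5 * (U / 4)) := mul_le_mul_of_nonneg_right hπ (by positivity)
    _ ≤ U := by linarith
    _ ≤ x ^ 2 * L ^ (-R) * Real.exp (-ℓ ^ 3) * B := hUle

end Summit.Parity.BatemanHorn.Cruxes.SystemZeroRepulsion.NearFar

end
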